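import Summits.AtomisticToContinuum.HydrodynamicLimit.Theorems.ImplosionDichotomyHydroLimitInBandEquilibrium
import Summits.AtomisticToContinuum.HydrodynamicLimit.Theorems.OneFlightGossipEngineUniformLocalGibbsConcentrationFields
import Literature.MathematicalPhysics.KineticTheory.LambertianHardSphereFlow
import HarnessLib

/-!
# `SwapGap` (stmt-AtomisticToContinuum-11850): stub S2 of line `Sketch` follows from an exponential-rate `LambertianEuler`

Helper file of line `Sketch` (card `entropy-relative-to-lambertian-law`) for the crux
`Summit.AtomisticToContinuum.HydrodynamicLimit.Theses.LambertianContactSwap.SwapGap`. The line's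
stochastic stub S2 (`LambertianFieldConcentration`: speed-`(N+1)` concentration of every bounded
`1`-Lipschitz statistic of the `χ`-tested fields of the Lambertian flow AROUND ITS MEAN, pre-shock) is
implied by the large-deviation refinement of the route's other crux `LambertianEuler`
(`LambertianEulerLD`: the three fields deviate from the EULER values with probability
`≤ C e^{-(N+1)/C}`). This records where S2 sits: it is no harder than a dynamical large-deviation upper
bound for the Lambertian gas towards its hydrodynamic limit (Kipnis–Landim 1999 Ch. 10 for lattice
gases; Rezakhanlou 1998 for stochastic collision models at kinetic scaling; nothing in print at fixed
reduced density).

* `expConc_sub_integral_of_expConc_sub_const` — abstract bookkeeping: on probability spaces, if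
  `|G_N| ≤ 1` concentrates exponentially (speed `N + 1`) around constants `c_N ∈ [-1, 1]`, then it
  concentrates exponentially around its own mean (`|∫ G_N − c_N| ≤ δ/4 + 2 C e^{-(N+1)/C}`; small `N`
  are absorbed into the constant; enlarging the constant is `UniformLGC.Kexp_le_Kexp`);
* `fieldConcentration_of_lambertianEulerLD` — S2 from `LambertianEulerLD` (union bound over the three
  fields for the sup distance, `1`-Lipschitz `F`, then the abstract lemma).

The `t = 0` instance of S2 (a theorem, from the landed static exponential law of large numbers for
local Gibbs states) is the sequel file `…FieldConcentrationTimeZero`.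

prover-line-stmt-AtomisticToContinuum-11850-0, cycle 1.
-/

noncomputable section

open MeasureTheory Filter Set Topology
open scoped ENNReal

namespace Summit.AtomisticToContinuum.HydrodynamicLimit.Theorems

open Literature.Analysis.FluidPDE Literature.MathematicalPhysics.KineticTheory

/-! ### Abstract bookkeeping: concentration around a constant gives concentration around the mean -/

/-- `C e^{-(N+1)/C} → 0`. [folklore] -/
theorem tendsto_const_mul_exp_neg_succ (C : ℝ) (hC : 0 < C) :
    Tendsto (fun N : ℕ => C * Real.exp (-(C⁻¹ * ((N : ℝ) + 1)))) atTop (𝓝 0) := by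
  have h1 : Tendsto (fun N : ℕ => C⁻¹ * ((N : ℝ) + 1)) atTop atTop :=
    (tendsto_atTop_add_const_right _ 1 tendsto_natCast_atTop_atTop).const_mul_atTop (inv_pos.2 hC)
  have h2 := (Real.tendsto_exp_atBot.comp (tendsto_neg_atTop_atBot.comp h1)).const_mul C
  rw [mul_zero] at h2
  exact h2

/-- **Exponential concentration around constants gives exponential concentration around the mean.**
On probability spaces `(Ω_N, μ_N)`, let `G_N` be measurable with `|G_N| ≤ 1` and `c_N ∈ [-1, 1]`. If for
every `δ > 0` there is `C > 0` with `μ_N{δ < |G_N − c_N|} ≤ C e^{-(N+1)/C}` for all `N`, then for every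
`δ > 0` there is `C > 0` with `μ_N{δ < |G_N − ∫ G_N dμ_N|} ≤ C e^{-(N+1)/C}` for all `N`. Proof:
`|∫ G_N − c_N| ≤ δ/4 + 2 μ_N{δ/4 < |G_N − c_N|} ≤ δ/4 + 2Ce^{-(N+1)/C}`, so for `N ≥ N₀` the event
`{δ < |G_N − mean|}` lies in `{δ/4 < |G_N − c_N|}`; the finitely many `N < N₀` are absorbed by taking the
constant `≥ max(N₀, 3)`. [folklore] -/
theorem expConc_sub_integral_of_expConc_sub_const {Ω : ℕ → Type*} [∀ N, MeasurableSpace (Ω N)]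
    (μ : (N : ℕ) → Measure (Ω N)) (hμ : ∀ N, IsProbabilityMeasure (μ N))
    (G : (N : ℕ) → Ω N → ℝ) (hG : ∀ N, Measurable (G N)) (hGb : ∀ N x, |G N x| ≤ 1)
    (c : ℕ → ℝ) (hc : ∀ N, |c N| ≤ 1)
    (h : ∀ δ : ℝ, 0 < δ → ∃ C : ℝ, 0 < C ∧ ∀ N : ℕ,
      μ N {x | δ < |G N x - c N|} ≤ ENNReal.ofReal (C * Real.exp (-(C⁻¹ * ((N : ℝ) + 1)))))
    {δ : ℝ} (hδ : 0 < δ) :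
    ∃ C : ℝ, 0 < C ∧ ∀ N : ℕ, μ N {x | δ < |G N x - ∫ y, G N y ∂μ N|} ≤
      ENNReal.ofReal (C * Real.exp (-(C⁻¹ * ((N : ℝ) + 1)))) := by
  obtain ⟨C, hC, hCN⟩ := h (δ / 4) (by positivity)
  set r : ℕ → ℝ := fun N => C * Real.exp (-(C⁻¹ * ((N : ℝ) + 1))) with hr
  have hr0 : ∀ N, 0 ≤ r N := fun N => by positivity
  -- the mean is close to the centre
  have hmean : ∀ N, |(∫ y, G N y ∂μ N) - c N| ≤ δ / 4 + 2 * r N := by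
    intro N
    haveI := hμ N
    set S : Set (Ω N) := {x | δ / 4 < |G N x - c N|} with hS
    have hSm : MeasurableSet S := measurableSet_lt measurable_const ((hG N).sub measurable_const).abs
    have hμS : (μ N).real S ≤ r N := ENNReal.toReal_le_of_le_ofReal (hr0 N) (hCN N)
    have hGi : Integrable (G N) (μ N) :=
      Integrable.of_bound (hG N).aestronglyMeasurable 1 (ae_of_all _ fun x => by
        rw [Real.norm_eq_abs]; exact hGb N x)
    have hpt : ∀ x, |G N x - c N| ≤ S.indicator (fun _ => (2 : ℝ)) x + δ / 4 := by
      intro x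
      by_cases hx : δ / 4 < |G N x - c N|
      · have hmem : x ∈ S := hx
        rw [Set.indicator_of_mem hmem]
        have h3 : |G N x - c N| ≤ |G N x| + |c N| := abs_sub _ _
        linarith [hGb N x, hc N]
      · have hmem : x ∉ S := hx
        rw [Set.indicator_of_notMem hmem, zero_add]
        exact not_lt.1 hx
    have hint : (∫ y, G N y ∂μ N) - c N = ∫ y, (G N y - c N) ∂μ N := by
      rw [integral_sub hGi (integrable_const _), integral_const, probReal_univ, one_smul]
    have hgi : Integrable (fun x => S.indicator (fun _ => (2 : ℝ)) x + δ / 4) (μ N) :=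
      ((integrable_const (2 : ℝ)).indicator hSm).add (integrable_const _)
    calc |(∫ y, G N y ∂μ N) - c N| = |∫ y, (G N y - c N) ∂μ N| := by rw [hint]
      _ ≤ ∫ y, |G N y - c N| ∂μ N := abs_integral_le_integral_abs
      _ ≤ ∫ y, (S.indicator (fun _ => (2 : ℝ)) y + δ / 4) ∂μ N :=
          integral_mono_of_nonneg (ae_of_all _ fun y => abs_nonneg _) hgi (ae_of_all _ hpt)
      _ = 2 * (μ N).real S + δ / 4 := by
          rw [integral_add ((integrable_const (2 : ℝ)).indicator hSm) (integrable_const _),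
            integral_indicator_const _ hSm, integral_const, probReal_univ, smul_eq_mul, smul_eq_mul,
            mul_comm, one_mul]
      _ ≤ δ / 4 + 2 * r N := by linarith
  -- eventually `2 r_N ≤ δ/2`
  have hev : ∀ᶠ N : ℕ in atTop, 2 * r N ≤ δ / 2 := by
    have ht : Tendsto (fun N => 2 * r N) atTop (𝓝 (2 * 0)) :=
      (tendsto_const_mul_exp_neg_succ C hC).const_mul 2
    rw [mul_zero] at ht
    exact ht.eventually (ge_mem_nhds (by positivity))
  obtain ⟨N₀, hN₀⟩ := eventually_atTop.1 hev
  -- the constant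
  set C' : ℝ := max C (max (N₀ : ℝ) 3) with hC'
  have hCC' : C ≤ C' := le_max_left _ _
  have hC'3 : (3 : ℝ) ≤ C' := (le_max_right _ _).trans (le_max_right _ _)
  have hC'N₀ : (N₀ : ℝ) ≤ C' := (le_max_left _ _).trans (le_max_right _ _)
  have hC'pos : 0 < C' := hC.trans_le hCC'
  refine ⟨C', hC'pos, fun N => ?_⟩
  haveI := hμ N
  by_cases hN : N₀ ≤ N
  · -- large `N`: the event is inside `{δ/4 < |G − c|}`
    have hsub : {x | δ < |G N x - ∫ y, G N y ∂μ N|} ⊆ {x | δ / 4 < |G N x - c N|} := by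
      intro x hx
      simp only [mem_setOf_eq] at hx ⊢
      have hm := hmean N
      have h2 := hN₀ N hN
      have htri : |G N x - ∫ y, G N y ∂μ N| ≤ |G N x - c N| + |(∫ y, G N y ∂μ N) - c N| := by
        have := abs_sub_le (G N x) (c N) (∫ y, G N y ∂μ N)
        rw [abs_sub_comm (c N)] at this
        exact this
      linarith
    calc μ N {x | δ < |G N x - ∫ y, G N y ∂μ N|} ≤ μ N {x | δ / 4 < |G N x - c N|} :=
          measure_mono hsub
      _ ≤ ENNReal.ofReal (r N) := hCN N
      _ ≤ ENNReal.ofReal (C' * Real.exp (-(C'⁻¹ * ((N : ℝ) + 1)))) :=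
          ENNReal.ofReal_le_ofReal (UniformLGC.Kexp_le_Kexp hC hCC' (by positivity))
  · -- small `N`: the bound is at least `1`
    have hN' : (N : ℝ) + 1 ≤ N₀ := by exact_mod_cast Nat.lt_of_not_le hN
    have hexp : Real.exp (-1) ≤ Real.exp (-(C'⁻¹ * ((N : ℝ) + 1))) := by
      refine Real.exp_le_exp.2 ?_
      have h1 : C'⁻¹ * ((N : ℝ) + 1) ≤ C'⁻¹ * C' :=
        mul_le_mul_of_nonneg_left (hN'.trans hC'N₀) (inv_nonneg.2 hC'pos.le)
      rw [inv_mul_cancel₀ hC'pos.ne'] at h1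
      linarith
    have he : (1 : ℝ) ≤ 3 * Real.exp (-1) := by
      have := Real.exp_one_lt_d9
      have h1 : Real.exp (-1) = (Real.exp 1)⁻¹ := Real.exp_neg 1
      rw [h1, ← div_eq_mul_inv, le_div_iff₀ (Real.exp_pos 1)]
      linarith
    have hone : (1 : ℝ) ≤ C' * Real.exp (-(C'⁻¹ * ((N : ℝ) + 1))) := by
      calc (1 : ℝ) ≤ 3 * Real.exp (-1) := he
        _ ≤ C' * Real.exp (-(C'⁻¹ * ((N : ℝ) + 1))) :=
            mul_le_mul hC'3 hexp (Real.exp_pos _).le hC'pos.le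
    calc μ N {x | δ < |G N x - ∫ y, G N y ∂μ N|} ≤ 1 := prob_le_one
      _ ≤ ENNReal.ofReal (C' * Real.exp (-(C'⁻¹ * ((N : ℝ) + 1)))) :=
          ENNReal.one_le_ofReal.2 hone

/-! ### S2 from an exponential-rate `LambertianEuler` -/

/-- **Stub S2 of line `Sketch` (`LambertianFieldConcentration`) follows from the large-deviation form of
`LambertianEuler`.** If, with the crux's quantifier prefix, the three `χ`-tested empirical fields of the
Lambertian flow deviate from the Euler values by more than `δ` with `P_N ⊗ γ^ℕ`-probability at most
`C e^{-(N+1)/C}` (pre-shock), then every `1`-Lipschitz `F` bounded by `1` of the field triple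
concentrates around its `P_N ⊗ γ^ℕ`-mean at speed `N + 1`. (Union bound for the sup distance on the
triple, `|F(X) − F(c)| ≤ dist(X, c)`, and `expConc_sub_integral_of_expConc_sub_const` with the constant
`F(c)`; `P_N ⊗ γ^ℕ` is a probability measure for `σ ≤ 1/2` and the integrand is measurable for
`σ < 1/2`.) [folklore] -/
theorem fieldConcentration_of_lambertianEulerLD
    (hLD : ∀ (a₀ θ₀ : T3 → ℝ) (u₀ : T3 → V3), Continuous a₀ → Continuous θ₀ → Continuous u₀ →
      (∀ x, 0 < a₀ x) → (∀ x, 0 < θ₀ x) →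
      ∃ σ₀ : ℝ, 0 < σ₀ ∧ ∀ σ : ℝ, 0 < σ → σ < σ₀ →
        ∀ (T : ℝ) (ρ θ : ℝ → T3 → ℝ) (u : ℝ → T3 → V3), IsHardSphereEulerSolution σ T ρ u θ →
          ∀ Φ : (N : ℕ) → HardSphereFlow (Torus.geometry (Fin 3)) (hsDiameter σ N) (N + 1),
            TendstoHydroFieldsAt (fun N => localGibbsLaw σ a₀ u₀ θ₀ N (Φ N)) Φ ρ u θ 0 →
              ∀ t ∈ Set.Ico 0 T, ∀ χ : T3 → ℝ, Continuous χ → ∀ δ : ℝ, 0 < δ →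
                ∃ C : ℝ, 0 < C ∧ ∀ N : ℕ,
                  ((localGibbsLaw σ a₀ u₀ θ₀ N (Φ N)).prod (lambertNoise (Fin 3)))
                      {p | δ < |empiricalDensityField
                          (lambertFlow (Torus.geometry (Fin 3)) (hsDiameter σ N) p.2 p.1 t) χ -
                        ∫ x, χ x * ρ t x|} ≤
                    ENNReal.ofReal (C * Real.exp (-(C⁻¹ * ((N : ℝ) + 1)))) ∧
                  ((localGibbsLaw σ a₀ u₀ θ₀ N (Φ N)).prod (lambertNoise (Fin 3)))
                      {p | δ < ‖empiricalMomentumField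
                          (lambertFlow (Torus.geometry (Fin 3)) (hsDiameter σ N) p.2 p.1 t) χ -
                        ∫ x, (χ x * ρ t x) • u t x‖} ≤
                    ENNReal.ofReal (C * Real.exp (-(C⁻¹ * ((N : ℝ) + 1)))) ∧
                  ((localGibbsLaw σ a₀ u₀ θ₀ N (Φ N)).prod (lambertNoise (Fin 3)))
                      {p | δ < |empiricalEnergyField
                          (lambertFlow (Torus.geometry (Fin 3)) (hsDiameter σ N) p.2 p.1 t) χ -
                        ∫ x, χ x * totalEnergyDensity (ρ t x) (u t x) (θ t x)|} ≤
                    ENNReal.ofReal (C * Real.exp (-(C⁻¹ * ((N : ℝ) + 1))))) :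
    ∀ (a₀ θ₀ : T3 → ℝ) (u₀ : T3 → V3), Continuous a₀ → Continuous θ₀ → Continuous u₀ →
      (∀ x, 0 < a₀ x) → (∀ x, 0 < θ₀ x) →
      ∃ σ₀ : ℝ, 0 < σ₀ ∧ ∀ σ : ℝ, 0 < σ → σ < σ₀ →
        ∀ (T : ℝ) (ρ θ : ℝ → T3 → ℝ) (u : ℝ → T3 → V3), IsHardSphereEulerSolution σ T ρ u θ →
          ∀ Φ : (N : ℕ) → HardSphereFlow (Torus.geometry (Fin 3)) (hsDiameter σ N) (N + 1),
            TendstoHydroFieldsAt (fun N => localGibbsLaw σ a₀ u₀ θ₀ N (Φ N)) Φ ρ u θ 0 →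
              ∀ t ∈ Set.Ico 0 T, ∀ χ : T3 → ℝ, Continuous χ →
                ∀ F : ℝ × V3 × ℝ → ℝ, LipschitzWith 1 F → (∀ y, |F y| ≤ 1) → ∀ δ : ℝ, 0 < δ →
                  ∃ C : ℝ, 0 < C ∧ ∀ N : ℕ,
                    ((localGibbsLaw σ a₀ u₀ θ₀ N (Φ N)).prod (lambertNoise (Fin 3)))
                      {p | δ < |F (empiricalDensityField
                              (lambertFlow (Torus.geometry (Fin 3)) (hsDiameter σ N) p.2 p.1 t) χ,
                            empiricalMomentumField
                              (lambertFlow (Torus.geometry (Fin 3)) (hsDiameter σ N) p.2 p.1 t) χ,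
                            empiricalEnergyField
                              (lambertFlow (Torus.geometry (Fin 3)) (hsDiameter σ N) p.2 p.1 t) χ) -
                          ∫ q, F (empiricalDensityField
                              (lambertFlow (Torus.geometry (Fin 3)) (hsDiameter σ N) q.2 q.1 t) χ,
                            empiricalMomentumField
                              (lambertFlow (Torus.geometry (Fin 3)) (hsDiameter σ N) q.2 q.1 t) χ,
                            empiricalEnergyField
                              (lambertFlow (Torus.geometry (Fin 3)) (hsDiameter σ N) q.2 q.1 t) χ)
                            ∂((localGibbsLaw σ a₀ u₀ θ₀ N (Φ N)).prod (lambertNoise (Fin 3)))|} ≤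
                      ENNReal.ofReal (C * Real.exp (-(C⁻¹ * ((N : ℝ) + 1)))) := by
  intro a₀ θ₀ u₀ ha hθ hu ha0 hθ0
  obtain ⟨σ₁, hσ₁, h1⟩ := hLD a₀ θ₀ u₀ ha hθ hu ha0 hθ0
  refine ⟨min 2⁻¹ σ₁, lt_min (by norm_num) hσ₁, ?_⟩
  intro σ hσ hσlt T ρ θ u hE Φ h0 t ht χ hχ F hF hF1 δ hδ
  have hσhalf : σ < 2⁻¹ := hσlt.trans_le (min_le_left _ _)
  have hσ₁' : σ < σ₁ := hσlt.trans_le (min_le_right _ _)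
  have hLDt := h1 σ hσ hσ₁' T ρ θ u hE Φ h0 t ht χ hχ
  -- notation
  set Q : (N : ℕ) → Measure (Config (N + 1) (Fin 3) T3 × (ℕ → EuclideanSpace ℝ (Fin 3))) :=
    fun N => (localGibbsLaw σ a₀ u₀ θ₀ N (Φ N)).prod (lambertNoise (Fin 3)) with hQ
  have hQN : ∀ N, IsProbabilityMeasure (Q N) := fun N => by
    haveI := isProbabilityMeasure_localGibbsLaw ha hθ hu ha0 hθ0 (by linarith) N (Φ N)
    rw [hQ]; infer_instance
  set X : (N : ℕ) → Config (N + 1) (Fin 3) T3 × (ℕ → EuclideanSpace ℝ (Fin 3)) → ℝ × V3 × ℝ :=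
    fun N p => (empiricalDensityField (lambertFlow (Torus.geometry (Fin 3)) (hsDiameter σ N) p.2 p.1 t) χ,
      empiricalMomentumField (lambertFlow (Torus.geometry (Fin 3)) (hsDiameter σ N) p.2 p.1 t) χ,
      empiricalEnergyField (lambertFlow (Torus.geometry (Fin 3)) (hsDiameter σ N) p.2 p.1 t) χ)
    with hX
  set c : ℝ × V3 × ℝ := (∫ x, χ x * ρ t x, ∫ x, (χ x * ρ t x) • u t x,
    ∫ x, χ x * totalEnergyDensity (ρ t x) (u t x) (θ t x)) with hc
  have hXm : ∀ N, Measurable (X N) := fun N =>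
    ((measurable_empiricalDensityField hχ).prodMk ((measurable_empiricalMomentumField hχ).prodMk
      (measurable_empiricalEnergyField hχ))).comp (measurable_lambertFlow_hsDiameter hσ.le hσhalf N t)
  -- exponential concentration of `F ∘ X` around the constant `F c`
  have hconst : ∀ δ' : ℝ, 0 < δ' → ∃ C : ℝ, 0 < C ∧ ∀ N : ℕ,
      Q N {p | δ' < |F (X N p) - F c|} ≤ ENNReal.ofReal (C * Real.exp (-(C⁻¹ * ((N : ℝ) + 1)))) := by
    intro δ' hδ'
    obtain ⟨C, hC, hCN⟩ := hLDt δ' hδ'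
    refine ⟨3 * C, by positivity, fun N => ?_⟩
    have hsub : {p | δ' < |F (X N p) - F c|} ⊆
        {p | δ' < |(X N p).1 - c.1|} ∪ {p | δ' < ‖(X N p).2.1 - c.2.1‖} ∪
          {p | δ' < |(X N p).2.2 - c.2.2|} := by
      intro p hp
      simp only [mem_setOf_eq] at hp
      have hd : δ' < dist (X N p) c := by
        have h1 : dist (F (X N p)) (F c) ≤ dist (X N p) c := by
          simpa using hF.dist_le_mul (X N p) c
        rw [Real.dist_eq] at h1
        exact hp.trans_le h1
      rw [Prod.dist_eq, Prod.dist_eq, Real.dist_eq, dist_eq_norm, Real.dist_eq] at hd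
      simp only [mem_union, mem_setOf_eq]
      rcases lt_max_iff.1 hd with h | h
      · exact Or.inl (Or.inl h)
      · rcases lt_max_iff.1 h with h' | h'
        · exact Or.inl (Or.inr h')
        · exact Or.inr h'
    obtain ⟨hD, hM, hEn⟩ := hCN N
    calc Q N {p | δ' < |F (X N p) - F c|}
        ≤ Q N {p | δ' < |(X N p).1 - c.1|} + Q N {p | δ' < ‖(X N p).2.1 - c.2.1‖} +
            Q N {p | δ' < |(X N p).2.2 - c.2.2|} :=
          (measure_mono hsub).trans
            ((measure_union_le _ _).trans (add_le_add (measure_union_le _ _) le_rfl))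
      _ ≤ ENNReal.ofReal (C * Real.exp (-(C⁻¹ * ((N : ℝ) + 1)))) +
            ENNReal.ofReal (C * Real.exp (-(C⁻¹ * ((N : ℝ) + 1)))) +
            ENNReal.ofReal (C * Real.exp (-(C⁻¹ * ((N : ℝ) + 1)))) :=
          add_le_add (add_le_add hD hM) hEn
      _ = ENNReal.ofReal (3 * (C * Real.exp (-(C⁻¹ * ((N : ℝ) + 1))))) := by
          rw [← ENNReal.ofReal_add (by positivity) (by positivity),
            ← ENNReal.ofReal_add (by positivity) (by positivity)]
          ring_nf
      _ ≤ ENNReal.ofReal (3 * C * Real.exp (-((3 * C)⁻¹ * ((N : ℝ) + 1)))) := by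
          refine ENNReal.ofReal_le_ofReal ?_
          rw [mul_assoc]
          refine mul_le_mul_of_nonneg_left (mul_le_mul_of_nonneg_left (Real.exp_le_exp.2 ?_) hC.le)
            (by norm_num)
          have h3 : (3 * C)⁻¹ ≤ C⁻¹ := inv_anti₀ hC (by linarith)
          have hN : (0 : ℝ) ≤ (N : ℝ) + 1 := by positivity
          nlinarith
  -- around the mean
  have hmain := expConc_sub_integral_of_expConc_sub_const Q hQN (fun N p => F (X N p))
    (fun N => hF.continuous.measurable.comp (hXm N)) (fun N p => hF1 _) (fun _ => F c)
    (fun _ => hF1 c) hconst hδ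
  simpa only [hX, hQ] using hmain

end Summit.AtomisticToContinuum.HydrodynamicLimit.Theorems
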